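import Mathlib
import HarnessLib
import Summits.HubbardSuperconductivity.HubbardSuperconductivity.Theorems.KLProgrammeKLRegimeVolumeLimitCauchyTermwise

/-!
# Route `KLProgramme` — VL child `KLRegimeVolumeLimitV12` (stmt-HubbardSuperconductivity-19858), Cauchy stub `stub_vl_twoVolumeRate`:
# SPLITTING THE TWO DIRECTIONS — a label-uniform Matsubara (`M → ∞`) limit at each volume plus a two-volume rate of the `M = ∞` objects
# give the registered two-volume inequality (cell gate-hubbard-kl, seat hubbard-kl-k3c4-p1 g4; division of labour between the all-`U`
# lane (cutoff removal at fixed volume) and the engine (volume rate of the cutoff-free objects))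

The registered stub compares the carrier at `(L, M)` and `(L′, M′)` for ALL `M ≥ Mth L`, `M′ ≥ Mth L′` at equal Matsubara integers.  Its two
directions separate cleanly:

* the CUTOFF direction at fixed volume — `hcut`: for every `L ≥ L₀` and `ε > 0` there is `M₁` with
  `‖S_{L,M}((ω,k),σ) − S∞_L(n_ω,k,σ)‖ ≤ ε` for all `M ≥ M₁`, UNIFORMLY in the kept label `ω` (`n_ω = matsubaraInt M ω`) and in `k`; here
  `S∞_L : ℤ → TorusSite 2 L → Fin 2 → ℂ` is any cutoff-free proxy (for the true carrier: the Hamiltonian-side objects of the all-`U` lane,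
  whose `M → ∞` statements are label-uniform through the time representation);
* the VOLUME direction for the cutoff-free objects — `hvol`: `‖S∞_L(n,k,σ) − S∞_{L′}(n,k′,σ)‖ ≤ ρ L + D·Σ_i |p_k i − p′_{k′} i|_𝕋` for
  `L₀ ≤ L ≤ L′` (the engine's debt, ruling (α)).

`twoVolumeRate_of_matsubaraLimit`: these give the stub's conclusion with the SAME `D`, thresholds `(L₀, Mth)` where `Mth L` realises `ε = 1/(L+1)`,
and rate `ρ L + 2/(L+1)`.  Pure bookkeeping (choice); nothing is asserted about the model.
-/

noncomputable section

namespace Summit.HubbardSuperconductivity.HubbardSuperconductivity.Theorems.KLRegimeSplit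

set_option linter.dupNamespace false -- summit = problem name (single-conjunct summit), D-0017

open Filter Topology Finset Literature.MathematicalPhysics.QuantumLattice Literature.Probability.LatticeModels
open Summit.HubbardSuperconductivity.HubbardSuperconductivity.Theorems.KLProgrammeLegKernels

/-- **Cutoff direction + volume direction ⇒ the Cauchy stub's inequality.**  See the module docstring. [folklore] -/
theorem twoVolumeRate_of_matsubaraLimit
    {S : ∀ (L M : ℕ) [NeZero L] [NeZero M], FreqMomentum L M → Fin 2 → ℂ}
    {Sinf : ∀ (L : ℕ) [NeZero L], ℤ → TorusSite 2 L → Fin 2 → ℂ} {L₀ : ℕ} {D : ℝ} {ρ : ℕ → ℝ}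
    (hρ : Tendsto ρ atTop (𝓝 0))
    (hcut : ∀ (L : ℕ) [NeZero L], L₀ ≤ L → ∀ ε : ℝ, 0 < ε → ∃ M₁ : ℕ, ∀ (M : ℕ) [NeZero M], M₁ ≤ M →
      ∀ (ω : MatsubaraIdx M) (k : TorusSite 2 L) (σ : Fin 2), ‖S L M (ω, k) σ - Sinf L (matsubaraInt M ω) k σ‖ ≤ ε)
    (hvol : ∀ (L : ℕ) [NeZero L], L₀ ≤ L → ∀ (L' : ℕ) [NeZero L'], L ≤ L' →
      ∀ (n : ℤ) (σ : Fin 2) (k : TorusSite 2 L) (k' : TorusSite 2 L'),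
        ‖Sinf L n k σ - Sinf L' n k' σ‖ ≤ ρ L + D * ∑ i, torusAbs (latticeMomentum L k i - latticeMomentum L' k' i)) :
    ∃ Mth : ℕ → ℕ, ∃ ρ' : ℕ → ℝ, Tendsto ρ' atTop (𝓝 0) ∧
      ∀ (L : ℕ) [NeZero L], L₀ ≤ L → ∀ (M : ℕ) [NeZero M], Mth L ≤ M →
        ∀ (L' : ℕ) [NeZero L'], L ≤ L' → ∀ (M' : ℕ) [NeZero M'], Mth L' ≤ M' →
          ∀ (σ : Fin 2) (ω : MatsubaraIdx M) (ω' : MatsubaraIdx M'), matsubaraInt M ω = matsubaraInt M' ω' →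
            ∀ (k : TorusSite 2 L) (k' : TorusSite 2 L'),
              ‖S L M (ω, k) σ - S L' M' (ω', k') σ‖ ≤ ρ' L + D * ∑ i, torusAbs (latticeMomentum L k i - latticeMomentum L' k' i) := by
  classical
  -- the precision `ε_L = 1/(L+1)` and the cutoff threshold realising it
  have hε : ∀ L : ℕ, (0 : ℝ) < 1 / ((L : ℝ) + 1) := fun L => by positivity
  set Mth : ℕ → ℕ := fun L =>
    if h : L ≠ 0 ∧ L₀ ≤ L then
      (by haveI : NeZero L := ⟨h.1⟩; exact Classical.choose (hcut L h.2 (1 / ((L : ℝ) + 1)) (hε L)))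
    else 0 with hMth
  have hMth_spec : ∀ (L : ℕ) [NeZero L], L₀ ≤ L → ∀ (M : ℕ) [NeZero M], Mth L ≤ M →
      ∀ (ω : MatsubaraIdx M) (k : TorusSite 2 L) (σ : Fin 2), ‖S L M (ω, k) σ - Sinf L (matsubaraInt M ω) k σ‖ ≤ 1 / ((L : ℝ) + 1) := by
    intro L _ hL M _ hM ω k σ
    have h : L ≠ 0 ∧ L₀ ≤ L := ⟨NeZero.ne L, hL⟩
    have hspec := Classical.choose_spec (hcut L h.2 (1 / ((L : ℝ) + 1)) (hε L))
    have hMth_eq : Mth L = Classical.choose (hcut L h.2 (1 / ((L : ℝ) + 1)) (hε L)) := by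
      simp only [hMth, dif_pos h]
    rw [hMth_eq] at hM
    exact hspec M hM ω k σ
  refine ⟨Mth, fun L => ρ L + 2 * (1 / ((L : ℝ) + 1)), ?_, ?_⟩
  · -- `ρ' → 0`
    have h1 : Tendsto (fun L : ℕ => 1 / ((L : ℝ) + 1)) atTop (𝓝 0) := tendsto_one_div_add_atTop_nhds_zero_nat
    simpa using hρ.add (h1.const_mul 2)
  · intro L _ hL M _ hM L' _ hLL' M' _ hM' σ ω ω' hωω' k k'
    have hL' : L₀ ≤ L' := hL.trans hLL'
    have e1 := hMth_spec L hL M hM ω k σ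
    have e2 := hMth_spec L' hL' M' hM' ω' k' σ
    have e3 := hvol L hL L' hLL' (matsubaraInt M ω) σ k k'
    rw [← hωω'] at e2
    have hanti : 1 / ((L' : ℝ) + 1) ≤ 1 / ((L : ℝ) + 1) :=
      one_div_le_one_div_of_le (by positivity) (by exact_mod_cast Nat.succ_le_succ hLL')
    calc ‖S L M (ω, k) σ - S L' M' (ω', k') σ‖
        = ‖(S L M (ω, k) σ - Sinf L (matsubaraInt M ω) k σ) +
            (Sinf L (matsubaraInt M ω) k σ - Sinf L' (matsubaraInt M ω) k' σ) -
            (S L' M' (ω', k') σ - Sinf L' (matsubaraInt M ω) k' σ)‖ := by congr 1; abel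
      _ ≤ ‖S L M (ω, k) σ - Sinf L (matsubaraInt M ω) k σ‖ +
            ‖Sinf L (matsubaraInt M ω) k σ - Sinf L' (matsubaraInt M ω) k' σ‖ +
            ‖S L' M' (ω', k') σ - Sinf L' (matsubaraInt M ω) k' σ‖ := norm_sub_le_of_le (norm_add_le _ _) le_rfl
      _ ≤ 1 / ((L : ℝ) + 1) + (ρ L + D * ∑ i, torusAbs (latticeMomentum L k i - latticeMomentum L' k' i)) +
            1 / ((L : ℝ) + 1) := add_le_add (add_le_add e1 e3) (e2.trans hanti)
      _ = ρ L + 2 * (1 / ((L : ℝ) + 1)) + D * ∑ i, torusAbs (latticeMomentum L k i - latticeMomentum L' k' i) := by ring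

end Summit.HubbardSuperconductivity.HubbardSuperconductivity.Theorems.KLRegimeSplit

end
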